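import Summits.CriticalPhenomena.PercolationContinuityZ3.Theorems.PercNearOneGluingNoHeavyLowerTailAGPlusBernsteinPieces
import Summits.CriticalPhenomena.PercolationContinuityZ3.Theorems.PercNearOneGluingNoHeavyLowerTailTIncBernsteinForcing
import Mathlib.Tactic.Linarith
import Mathlib.Tactic.LinearCombination
import HarnessLib

/-!
# `NoHeavyLowerTail` (stmt-CriticalPhenomena-4575) — (BΞ1),(BΞ2) for AG⁺, III: the apex step at a random apex pair (de Casteljau) —
# `0 ≤ xiB₁, xiB₂` at the cells `PrW D p (evZ ∅ a b c)` and transitions `PrW D p (evQ ∅ ∩ evU₁ {s(a,y)})`, … for EVERY `D` (containing `s(a,y)` or not)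

Support file (prover prim-l12-p6 gen 3; `--supports stmt-CriticalPhenomena-4575`).  No definitions, no named facts, no sorries.  The AG⁺ twin of
`…TIncBernsteinStepHyp` at `K = ∅`:
* `xi_glued_nonneg` — `0 ≤ Ξ(c¹)` at the glued law `S ↦ S ∪ {e}` (`AGPlusSwitching.agPlus_PrW` through `ThreePointGamma.PrW_insert_forced`);
  `xi_plain_nonneg` — `0 ≤ Ξ(c⁰)`;
* `xiB₁_deCasteljau`, `xiB₂_deCasteljau` (`ring`; the no-transition identities `xiB_i(c,0) = 3·Ξ(c)` are prim-l12-p1's `TerminalEdgeStep.xiB₁/₂_transition_zero`);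
* `xiStep_core` (`s(a,y) ∉ D`): from `AGPlusFibre.xiB₁/₂_nonneg_of_transitions` + prove-2's `trans_*` at `K = ∅`;
* `xiStep_random` (`s(a,y) ∈ D`): the law is `(1−p_e)c⁰ + p_e c¹` on the pencil of `D ∖ e`, transitions scale by `(1−p_e)`, de Casteljau.
Used by `…AGPlusBernsteinMeasure` for the `prodBernoulli` statements and prim-bnk-1's rung `XiStepUpTo N₀` for every `N₀`.  [this work]
-/

noncomputable section

namespace Summit.CriticalPhenomena.PercolationContinuityZ3.Theorems

namespace AGPlusFibre

open Finset Literature.Probability.Percolation Literature.Probability.Percolation.DecisionTree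
open Literature.Probability.Percolation.Gladkov ThreePointLB TIncSwitching AGPlusSwitching TIncFibre CubicThreePointStep ThreePointGamma
open CubicThreePointTerminal (Xi)
open TerminalEdgeStep (xiB₁ xiB₂)
open scoped Classical

variable {V : Type*} [Fintype V] [DecidableEq V]

section Algebra

variable {R : Type*} [CommRing R]

/-- de Casteljau for `xiB₁` on the sub-pencil `[(1−s)c⁰ + s c¹, c¹]`. [folklore] -/
theorem xiB₁_deCasteljau (q u₁ u₂ u₃ t α₁ α₂ β₁ β₂ β₃ s : R) :
    xiB₁ (q + s * (-α₁ - α₂)) (u₁ + s * (α₁ - β₁)) (u₂ + s * (α₂ - β₂)) (u₃ + s * (-β₃)) (t + s * (β₁ + β₂ + β₃))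
        ((1 - s) * α₁) ((1 - s) * α₂) ((1 - s) * β₁) ((1 - s) * β₂) ((1 - s) * β₃) =
      (1 - s) ^ 2 * xiB₁ q u₁ u₂ u₃ t α₁ α₂ β₁ β₂ β₃ + 2 * s * (1 - s) * xiB₂ q u₁ u₂ u₃ t α₁ α₂ β₁ β₂ β₃ +
        3 * s ^ 2 * Xi (q - α₁ - α₂) (u₁ + α₁ - β₁) (u₂ + α₂ - β₂) (u₃ - β₃) (t + β₁ + β₂ + β₃) := by
  simp only [xiB₁, xiB₂, Xi]; ring

/-- de Casteljau for `xiB₂`. [folklore] -/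
theorem xiB₂_deCasteljau (q u₁ u₂ u₃ t α₁ α₂ β₁ β₂ β₃ s : R) :
    xiB₂ (q + s * (-α₁ - α₂)) (u₁ + s * (α₁ - β₁)) (u₂ + s * (α₂ - β₂)) (u₃ + s * (-β₃)) (t + s * (β₁ + β₂ + β₃))
        ((1 - s) * α₁) ((1 - s) * α₂) ((1 - s) * β₁) ((1 - s) * β₂) ((1 - s) * β₃) =
      (1 - s) * xiB₂ q u₁ u₂ u₃ t α₁ α₂ β₁ β₂ β₃ +
        3 * s * Xi (q - α₁ - α₂) (u₁ + α₁ - β₁) (u₂ + α₂ - β₂) (u₃ - β₃) (t + β₁ + β₂ + β₃) := by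
  simp only [xiB₂, Xi]; ring

end Algebra

section Xi

variable {p : Sym2 V → ℝ} (hp0 : ∀ i, 0 ≤ p i) (hp1 : ∀ i, p i ≤ 1) (D : Finset (Sym2 V)) (a b c : V)
include hp0 hp1

/-- `0 ≤ Ξ(c⁰)`: AG⁺ at the plain law `PrW D p` (`agPlus_PrW`, normalised). [this work] -/
theorem xi_plain_nonneg :
    0 ≤ Xi (PrW D p ((conn a b)ᶜ ∩ ((conn a c)ᶜ ∩ (conn b c)ᶜ))) (PrW D p (conn a b ∩ (conn a c)ᶜ)) (PrW D p (conn a c ∩ (conn a b)ᶜ))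
      (PrW D p (conn b c ∩ (conn a b)ᶜ)) (PrW D p (conn a b ∩ conn a c)) := by
  have key := agPlus_PrW hp0 hp1 D a b c
  have hsum := push_univ p D (fun S => S) a b c
  simp only [Set.setOf_mem_eq, PrW_univ] at hsum
  set q := PrW D p ((conn a b)ᶜ ∩ ((conn a c)ᶜ ∩ (conn b c)ᶜ))
  set t := PrW D p (conn a b ∩ conn a c)
  set uc := PrW D p (conn a b ∩ (conn a c)ᶜ)
  set ub := PrW D p (conn a c ∩ (conn a b)ᶜ)
  set ua := PrW D p (conn b c ∩ (conn a b)ᶜ)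
  have hXi : Xi q uc ub ua t = (q * t - (uc * ub + uc * ua + ub * ua)) - uc * ub * ua := by
    simp only [Xi]
    linear_combination (q * t - (uc * ub + uc * ua + ub * ua)) * hsum.symm
  rw [hXi]; linarith

/-- `0 ≤ Ξ(c¹)`: AG⁺ at the glued law `S ↦ S ∪ {e}` (`e ∉ D`). [this work] -/
theorem xi_glued_nonneg {e : Sym2 V} (he : e ∉ D) :
    0 ≤ Xi (PrW D p {S | insert e S ∈ ((conn a b)ᶜ ∩ ((conn a c)ᶜ ∩ (conn b c)ᶜ))}) (PrW D p {S | insert e S ∈ (conn a b ∩ (conn a c)ᶜ)})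
      (PrW D p {S | insert e S ∈ (conn a c ∩ (conn a b)ᶜ)}) (PrW D p {S | insert e S ∈ (conn b c ∩ (conn a b)ᶜ)})
      (PrW D p {S | insert e S ∈ (conn a b ∩ conn a c)}) := by
  have hp0' : ∀ i, 0 ≤ Function.update p e (1 : ℝ) i := by
    intro i
    by_cases hi : i = e
    · rw [hi, Function.update_self]; norm_num
    · rw [Function.update_of_ne hi]; exact hp0 i
  have hp1' : ∀ i, Function.update p e (1 : ℝ) i ≤ 1 := by
    intro i
    by_cases hi : i = e
    · rw [hi, Function.update_self]
    · rw [Function.update_of_ne hi]; exact hp1 i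
  have h := xi_plain_nonneg hp0' hp1' (insert e D) a b c
  simp only [PrW_insert_forced D p he] at h
  exact h

end Xi

section Step

variable {p : Sym2 V → ℝ} (hp0 : ∀ i, 0 ≤ p i) (hp1 : ∀ i, p i ≤ 1)
include hp0 hp1

/-- **(BΞ1),(BΞ2), apex pair `s(a,y) ∉ D`**, at the cells of `PrW D p` (`K = ∅` vocabulary of prove-2) and the transition masses
`PrW D p (evQ ∅ ∩ evU₁ {s(a,y)})`, … . [this work] -/
theorem xiStep_core {D : Finset (Sym2 V)} {a b c y : V} (heD : s(a, y) ∉ D) :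
    0 ≤ xiB₁ (PrW D p (evQ ∅ a b c)) (PrW D p (evU₁ ∅ a b c)) (PrW D p (evU₂ ∅ a b c)) (PrW D p (evU₃ ∅ a b c)) (PrW D p (evT ∅ a b c))
        (PrW D p (evQ ∅ a b c ∩ evU₁ (insert s(a, y) ∅) a b c)) (PrW D p (evQ ∅ a b c ∩ evU₂ (insert s(a, y) ∅) a b c))
        (PrW D p (evU₁ ∅ a b c ∩ evT (insert s(a, y) ∅) a b c)) (PrW D p (evU₂ ∅ a b c ∩ evT (insert s(a, y) ∅) a b c))
        (PrW D p (evU₃ ∅ a b c ∩ evT (insert s(a, y) ∅) a b c)) ∧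
      0 ≤ xiB₂ (PrW D p (evQ ∅ a b c)) (PrW D p (evU₁ ∅ a b c)) (PrW D p (evU₂ ∅ a b c)) (PrW D p (evU₃ ∅ a b c)) (PrW D p (evT ∅ a b c))
        (PrW D p (evQ ∅ a b c ∩ evU₁ (insert s(a, y) ∅) a b c)) (PrW D p (evQ ∅ a b c ∩ evU₂ (insert s(a, y) ∅) a b c))
        (PrW D p (evU₁ ∅ a b c ∩ evT (insert s(a, y) ∅) a b c)) (PrW D p (evU₂ ∅ a b c ∩ evT (insert s(a, y) ∅) a b c))
        (PrW D p (evU₃ ∅ a b c ∩ evT (insert s(a, y) ∅) a b c)) := by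
  set e := s(a, y) with he_def
  have hax : ∀ S : Finset (Sym2 V), CubicThreePointStep.R ∅ S a a := fun S => R_refl ∅ S a
  -- glued cells = sections
  have gQ : PrW D p (evQ (insert e ∅) a b c) = PrW D p {S | insert e S ∈ ((conn a b)ᶜ ∩ ((conn a c)ᶜ ∩ (conn b c)ᶜ))} := by
    rw [← sect_evQ, evQ_empty]
  have gT : PrW D p (evT (insert e ∅) a b c) = PrW D p {S | insert e S ∈ (conn a b ∩ conn a c)} := by
    rw [← sect_evT, evT_empty]
  have g1 : PrW D p (evU₁ (insert e ∅) a b c) = PrW D p {S | insert e S ∈ (conn a b ∩ (conn a c)ᶜ)} := by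
    rw [← sect_evU₁, evU₁_empty]
  have g2 : PrW D p (evU₂ (insert e ∅) a b c) = PrW D p {S | insert e S ∈ (conn a c ∩ (conn a b)ᶜ)} := by
    rw [← sect_evU₂, evU₂_empty]
  have g3 : PrW D p (evU₃ (insert e ∅) a b c) = PrW D p {S | insert e S ∈ (conn b c ∩ (conn a b)ᶜ)} := by
    rw [← sect_evU₃, evU₃_empty]
  have tQ := trans_Q D p (K := ∅) (b := b) (c := c) (m := y) hax
  have t1 := trans_U₁ D p (K := ∅) (a := a) (b := b) (c := c) (x := a) (m := y)
  have t2 := trans_U₂ D p (K := ∅) (a := a) (b := b) (c := c) (x := a) (m := y)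
  have t3 := trans_U₃ D p (K := ∅) (b := b) (c := c) (m := y) hax
  have tT := trans_T D p (K := ∅) (b := b) (c := c) (m := y) hax
  rw [gQ] at tQ
  rw [g1] at t1
  rw [g2] at t2
  rw [g3] at t3
  rw [gT] at tT
  simp only [evQ_empty, evT_empty, evU₁_empty, evU₂_empty, evU₃_empty] at tQ t1 t2 t3 tT ⊢
  exact ⟨xiB₁_nonneg_of_transitions hp0 hp1 D a b c heD (by linarith) (by linarith) (by linarith) (by linarith) (by linarith),
    xiB₂_nonneg_of_transitions hp0 hp1 D a b c heD (by linarith) (by linarith) (by linarith) (by linarith) (by linarith)⟩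

/-- **(BΞ1),(BΞ2), apex pair `s(a,y) ∈ D` random** (de Casteljau from the pencil of `D ∖ e`). [this work] -/
theorem xiStep_random {D : Finset (Sym2 V)} {a b c y : V} (heD : s(a, y) ∈ D) :
    0 ≤ xiB₁ (PrW D p (evQ ∅ a b c)) (PrW D p (evU₁ ∅ a b c)) (PrW D p (evU₂ ∅ a b c)) (PrW D p (evU₃ ∅ a b c)) (PrW D p (evT ∅ a b c))
        (PrW D p (evQ ∅ a b c ∩ evU₁ (insert s(a, y) ∅) a b c)) (PrW D p (evQ ∅ a b c ∩ evU₂ (insert s(a, y) ∅) a b c))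
        (PrW D p (evU₁ ∅ a b c ∩ evT (insert s(a, y) ∅) a b c)) (PrW D p (evU₂ ∅ a b c ∩ evT (insert s(a, y) ∅) a b c))
        (PrW D p (evU₃ ∅ a b c ∩ evT (insert s(a, y) ∅) a b c)) ∧
      0 ≤ xiB₂ (PrW D p (evQ ∅ a b c)) (PrW D p (evU₁ ∅ a b c)) (PrW D p (evU₂ ∅ a b c)) (PrW D p (evU₃ ∅ a b c)) (PrW D p (evT ∅ a b c))
        (PrW D p (evQ ∅ a b c ∩ evU₁ (insert s(a, y) ∅) a b c)) (PrW D p (evQ ∅ a b c ∩ evU₂ (insert s(a, y) ∅) a b c))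
        (PrW D p (evU₁ ∅ a b c ∩ evT (insert s(a, y) ∅) a b c)) (PrW D p (evU₂ ∅ a b c ∩ evT (insert s(a, y) ∅) a b c))
        (PrW D p (evU₃ ∅ a b c ∩ evT (insert s(a, y) ∅) a b c)) := by
  set e := s(a, y) with he_def
  set D' := D.erase e with hD'
  have heD' : e ∉ D' := Finset.notMem_erase e D
  have hD : D = insert e D' := (Finset.insert_erase heD).symm
  have hax : ∀ S : Finset (Sym2 V), CubicThreePointStep.R ∅ S a a := fun S => R_refl ∅ S a
  have sq : PrW D p (evQ ∅ a b c) = (1 - p e) * PrW D' p (evQ ∅ a b c) + p e * PrW D' p (evQ (insert e ∅) a b c) := by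
    rw [hD, CubicThreePointStep.PrW_split D' p heD', sect_evQ]
  have s1 : PrW D p (evU₁ ∅ a b c) = (1 - p e) * PrW D' p (evU₁ ∅ a b c) + p e * PrW D' p (evU₁ (insert e ∅) a b c) := by
    rw [hD, CubicThreePointStep.PrW_split D' p heD', sect_evU₁]
  have s2 : PrW D p (evU₂ ∅ a b c) = (1 - p e) * PrW D' p (evU₂ ∅ a b c) + p e * PrW D' p (evU₂ (insert e ∅) a b c) := by
    rw [hD, CubicThreePointStep.PrW_split D' p heD', sect_evU₂]
  have s3 : PrW D p (evU₃ ∅ a b c) = (1 - p e) * PrW D' p (evU₃ ∅ a b c) + p e * PrW D' p (evU₃ (insert e ∅) a b c) := by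
    rw [hD, CubicThreePointStep.PrW_split D' p heD', sect_evU₃]
  have sT : PrW D p (evT ∅ a b c) = (1 - p e) * PrW D' p (evT ∅ a b c) + p e * PrW D' p (evT (insert e ∅) a b c) := by
    rw [hD, CubicThreePointStep.PrW_split D' p heD', sect_evT]
  have hRR : ∀ (u v : V) (S : Finset (Sym2 V)),
      CubicThreePointStep.R (insert e ∅) (insert e S) u v ↔ CubicThreePointStep.R ∅ (insert e S) u v := by
    intro u v S; rw [R_insert_config_iff, R_insert_config_iff, Finset.insert_idem]
  have z1 : PrW D' p {S | insert e S ∈ evQ ∅ a b c ∩ evU₁ (insert e ∅) a b c} = 0 :=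
    PrW_eq_zero_of_forall D' p fun S _ h => h.1.1 ((hRR a b S).1 h.2.1)
  have z2 : PrW D' p {S | insert e S ∈ evQ ∅ a b c ∩ evU₂ (insert e ∅) a b c} = 0 :=
    PrW_eq_zero_of_forall D' p fun S _ h => h.1.2.1 ((hRR a c S).1 h.2.1)
  have z3 : PrW D' p {S | insert e S ∈ evU₁ ∅ a b c ∩ evT (insert e ∅) a b c} = 0 :=
    PrW_eq_zero_of_forall D' p fun S _ h => h.1.2 ((hRR a c S).1 h.2.2)
  have z4 : PrW D' p {S | insert e S ∈ evU₂ ∅ a b c ∩ evT (insert e ∅) a b c} = 0 :=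
    PrW_eq_zero_of_forall D' p fun S _ h => h.1.2 ((hRR a b S).1 h.2.1)
  have z5 : PrW D' p {S | insert e S ∈ evU₃ ∅ a b c ∩ evT (insert e ∅) a b c} = 0 :=
    PrW_eq_zero_of_forall D' p fun S _ h => h.1.2 ((hRR a b S).1 h.2.1)
  have r1 : PrW D p (evQ ∅ a b c ∩ evU₁ (insert e ∅) a b c) = (1 - p e) * PrW D' p (evQ ∅ a b c ∩ evU₁ (insert e ∅) a b c) := by
    rw [hD, CubicThreePointStep.PrW_split D' p heD', z1]; ring
  have r2 : PrW D p (evQ ∅ a b c ∩ evU₂ (insert e ∅) a b c) = (1 - p e) * PrW D' p (evQ ∅ a b c ∩ evU₂ (insert e ∅) a b c) := by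
    rw [hD, CubicThreePointStep.PrW_split D' p heD', z2]; ring
  have r3 : PrW D p (evU₁ ∅ a b c ∩ evT (insert e ∅) a b c) = (1 - p e) * PrW D' p (evU₁ ∅ a b c ∩ evT (insert e ∅) a b c) := by
    rw [hD, CubicThreePointStep.PrW_split D' p heD', z3]; ring
  have r4 : PrW D p (evU₂ ∅ a b c ∩ evT (insert e ∅) a b c) = (1 - p e) * PrW D' p (evU₂ ∅ a b c ∩ evT (insert e ∅) a b c) := by
    rw [hD, CubicThreePointStep.PrW_split D' p heD', z4]; ring
  have r5 : PrW D p (evU₃ ∅ a b c ∩ evT (insert e ∅) a b c) = (1 - p e) * PrW D' p (evU₃ ∅ a b c ∩ evT (insert e ∅) a b c) := by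
    rw [hD, CubicThreePointStep.PrW_split D' p heD', z5]; ring
  have tQ := trans_Q D' p (K := ∅) (b := b) (c := c) (m := y) hax
  have t1 := trans_U₁ D' p (K := ∅) (a := a) (b := b) (c := c) (x := a) (m := y)
  have t2 := trans_U₂ D' p (K := ∅) (a := a) (b := b) (c := c) (x := a) (m := y)
  have t3 := trans_U₃ D' p (K := ∅) (b := b) (c := c) (m := y) hax
  have tT := trans_T D' p (K := ∅) (b := b) (c := c) (m := y) hax
  set q := PrW D' p (evQ ∅ a b c)
  set u₁ := PrW D' p (evU₁ ∅ a b c)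
  set u₂ := PrW D' p (evU₂ ∅ a b c)
  set u₃ := PrW D' p (evU₃ ∅ a b c)
  set t := PrW D' p (evT ∅ a b c)
  set α₁ := PrW D' p (evQ ∅ a b c ∩ evU₁ (insert e ∅) a b c)
  set α₂ := PrW D' p (evQ ∅ a b c ∩ evU₂ (insert e ∅) a b c)
  set β₁ := PrW D' p (evU₁ ∅ a b c ∩ evT (insert e ∅) a b c)
  set β₂ := PrW D' p (evU₂ ∅ a b c ∩ evT (insert e ∅) a b c)
  set β₃ := PrW D' p (evU₃ ∅ a b c ∩ evT (insert e ∅) a b c)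
  have hq1 : PrW D' p (evQ (insert e ∅) a b c) = q - α₁ - α₂ := by linarith
  have hu1 : PrW D' p (evU₁ (insert e ∅) a b c) = u₁ + α₁ - β₁ := by linarith
  have hu2 : PrW D' p (evU₂ (insert e ∅) a b c) = u₂ + α₂ - β₂ := by linarith
  have hu3 : PrW D' p (evU₃ (insert e ∅) a b c) = u₃ - β₃ := by linarith
  have ht1 : PrW D' p (evT (insert e ∅) a b c) = t + β₁ + β₂ + β₃ := by linarith
  rw [sq, s1, s2, s3, sT, r1, r2, r3, r4, r5, hq1, hu1, hu2, hu3, ht1]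
  set s := p e with hs
  have e1 : (1 - s) * q + s * (q - α₁ - α₂) = q + s * (-α₁ - α₂) := by ring
  have e2 : (1 - s) * u₁ + s * (u₁ + α₁ - β₁) = u₁ + s * (α₁ - β₁) := by ring
  have e3 : (1 - s) * u₂ + s * (u₂ + α₂ - β₂) = u₂ + s * (α₂ - β₂) := by ring
  have e4 : (1 - s) * u₃ + s * (u₃ - β₃) = u₃ + s * (-β₃) := by ring
  have e5 : (1 - s) * t + s * (t + β₁ + β₂ + β₃) = t + s * (β₁ + β₂ + β₃) := by ring
  rw [e1, e2, e3, e4, e5, xiB₁_deCasteljau, xiB₂_deCasteljau]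
  obtain ⟨hB1, hB2⟩ := xiStep_core hp0 hp1 (D := D') (a := a) (b := b) (c := c) (y := y) heD'
  have hX1 : 0 ≤ Xi (q - α₁ - α₂) (u₁ + α₁ - β₁) (u₂ + α₂ - β₂) (u₃ - β₃) (t + β₁ + β₂ + β₃) := by
    have h := xi_glued_nonneg hp0 hp1 D' a b c heD'
    have gQ : PrW D' p (evQ (insert e ∅) a b c) = PrW D' p {S | insert e S ∈ ((conn a b)ᶜ ∩ ((conn a c)ᶜ ∩ (conn b c)ᶜ))} := by
      rw [← sect_evQ, evQ_empty]
    have gT : PrW D' p (evT (insert e ∅) a b c) = PrW D' p {S | insert e S ∈ (conn a b ∩ conn a c)} := by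
      rw [← sect_evT, evT_empty]
    have g1 : PrW D' p (evU₁ (insert e ∅) a b c) = PrW D' p {S | insert e S ∈ (conn a b ∩ (conn a c)ᶜ)} := by
      rw [← sect_evU₁, evU₁_empty]
    have g2 : PrW D' p (evU₂ (insert e ∅) a b c) = PrW D' p {S | insert e S ∈ (conn a c ∩ (conn a b)ᶜ)} := by
      rw [← sect_evU₂, evU₂_empty]
    have g3 : PrW D' p (evU₃ (insert e ∅) a b c) = PrW D' p {S | insert e S ∈ (conn b c ∩ (conn a b)ᶜ)} := by
      rw [← sect_evU₃, evU₃_empty]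
    rw [← gQ, ← gT, ← g1, ← g2, ← g3, hq1, hu1, hu2, hu3, ht1] at h
    exact h
  have hs0 : 0 ≤ s := hp0 e
  have hs1 : 0 ≤ 1 - s := sub_nonneg.2 (hp1 e)
  refine ⟨?_, ?_⟩
  · have h1 : 0 ≤ (1 - s) ^ 2 * xiB₁ q u₁ u₂ u₃ t α₁ α₂ β₁ β₂ β₃ := mul_nonneg (pow_nonneg hs1 2) hB1
    have h2 : 0 ≤ 2 * s * (1 - s) * xiB₂ q u₁ u₂ u₃ t α₁ α₂ β₁ β₂ β₃ :=
      mul_nonneg (mul_nonneg (mul_nonneg (by norm_num) hs0) hs1) hB2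
    have h3 : 0 ≤ 3 * s ^ 2 * Xi (q - α₁ - α₂) (u₁ + α₁ - β₁) (u₂ + α₂ - β₂) (u₃ - β₃) (t + β₁ + β₂ + β₃) :=
      mul_nonneg (mul_nonneg (by norm_num) (pow_nonneg hs0 2)) hX1
    linarith
  · have h2 : 0 ≤ (1 - s) * xiB₂ q u₁ u₂ u₃ t α₁ α₂ β₁ β₂ β₃ := mul_nonneg hs1 hB2
    have h3 : 0 ≤ 3 * s * Xi (q - α₁ - α₂) (u₁ + α₁ - β₁) (u₂ + α₂ - β₂) (u₃ - β₃) (t + β₁ + β₂ + β₃) :=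
      mul_nonneg (mul_nonneg (by norm_num) hs0) hX1
    linarith

/-- **(BΞ1),(BΞ2) for every `D`** (apex pair random or absent). [this work] -/
theorem xiStep {D : Finset (Sym2 V)} {a b c y : V} :
    0 ≤ xiB₁ (PrW D p (evQ ∅ a b c)) (PrW D p (evU₁ ∅ a b c)) (PrW D p (evU₂ ∅ a b c)) (PrW D p (evU₃ ∅ a b c)) (PrW D p (evT ∅ a b c))
        (PrW D p (evQ ∅ a b c ∩ evU₁ (insert s(a, y) ∅) a b c)) (PrW D p (evQ ∅ a b c ∩ evU₂ (insert s(a, y) ∅) a b c))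
        (PrW D p (evU₁ ∅ a b c ∩ evT (insert s(a, y) ∅) a b c)) (PrW D p (evU₂ ∅ a b c ∩ evT (insert s(a, y) ∅) a b c))
        (PrW D p (evU₃ ∅ a b c ∩ evT (insert s(a, y) ∅) a b c)) ∧
      0 ≤ xiB₂ (PrW D p (evQ ∅ a b c)) (PrW D p (evU₁ ∅ a b c)) (PrW D p (evU₂ ∅ a b c)) (PrW D p (evU₃ ∅ a b c)) (PrW D p (evT ∅ a b c))
        (PrW D p (evQ ∅ a b c ∩ evU₁ (insert s(a, y) ∅) a b c)) (PrW D p (evQ ∅ a b c ∩ evU₂ (insert s(a, y) ∅) a b c))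
        (PrW D p (evU₁ ∅ a b c ∩ evT (insert s(a, y) ∅) a b c)) (PrW D p (evU₂ ∅ a b c ∩ evT (insert s(a, y) ∅) a b c))
        (PrW D p (evU₃ ∅ a b c ∩ evT (insert s(a, y) ∅) a b c)) := by
  by_cases heD : s(a, y) ∈ D
  · exact xiStep_random hp0 hp1 heD
  · exact xiStep_core hp0 hp1 heD

end Step

end AGPlusFibre

end Summit.CriticalPhenomena.PercolationContinuityZ3.Theorems

end
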